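import Summits.ResolutionOfSingularities.ResolutionOfSingularities.Theorems.PurelyInseparableDim4PureLeafKMoves
import HarnessLib
import HarnessLib.Audit.Tags

/-!
# Purely inseparable fourfolds — the SINGLETON CRITERION and the MEASURE of the general form over ANY field of characteristic `p`
# (cell res-dim4-pi; D3d kit H_K: kit H `…PureLeafFpCentres` with a finite root set `R ⊂ K`)
# [OURS · counted 0 · bookkeeping identities of OUR frame, not about resolution]

Width seat `res-dim4-p-10` (g3).  For the general form `T(R,k)·(N(R,μ) − C γ(R,μ))` of kits F_K/G_K:

* §1 `coeff_corner_add_single_mul` — a CORNER×LINEAR coefficient of a product: if every monomial of `T` lies above `m` and `B` has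
  no constant term, `coeff_{m + eᵢ}(T·B) = coeff_m T · coeff_{eᵢ} B` (replaces the `p`-adic digit lemma of kit H);
* §2 `coeff_single_splitForm`, `coeff_single_bracket_ne_zero`, `coeff_zero_bracket`, and **`ordAlong_singleton_generalForm_le_one`**:
  in the bracket regime of a CLEANED state (constant `γ(R,μ)`), a variable without an `x_j^p` in `T` has `ord_{(x_j)} ≤ 1`;
* §3 the measure `W(R; k, μ) = Σᵢ Σ_{c∈R} (p·k i c + μ i c)`: `weight_shift` (root shifts onto `R′`), `weight_singleton_chart` (`−p`),
  `weight_block_chart_lt`.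

Nothing here proves resolution of singularities in dimension ≥ 4 / characteristic `p`; counted 0; AI work, weaker than expert
review. bears_on: LADDER-RESOLUTION:D157-DOOR2 (res-dim4-pi · D3d kit H_K). Supports stmt-ResolutionOfSingularities-16155 (helper).
-/

set_option linter.dupNamespace false

open MvPolynomial Finset

open scoped BigOperators

noncomputable section

namespace Summit.ResolutionOfSingularities.ResolutionOfSingularities.Theorems.PIDim4

namespace PureLeafK

open Literature.AlgebraicGeometry.Resolution
open Literature.AlgebraicGeometry.Resolution.Hauser2010
open CentreBlowup PthPowerFactor PureLeafNF

variable {σ : Type*} [Fintype σ] [DecidableEq σ] {K : Type*} [Field K] [DecidableEq K] (p : ℕ) [Fact p.Prime] [CharP K p]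

/-! ## 1. A corner × linear coefficient -/

omit [Fintype σ] [DecidableEq K] [Fact p.Prime] [CharP K p] in
/-- **Corner × linear**: if every monomial of `T` lies above `m` and `B(0) = 0`, then `coeff_{m + eᵢ} (T·B) = coeff_m T · coeff_{eᵢ} B`.
[folklore] -/
theorem coeff_corner_add_single_mul {L : Type*} [CommRing L] (T B : MvPolynomial σ L) (m : σ →₀ ℕ)
    (hT : ∀ u ∈ T.support, m ≤ u) (hB0 : coeff 0 B = 0) (i : σ) :
    coeff (m + Finsupp.single i 1) (T * B) = coeff m T * coeff (Finsupp.single i 1) B := by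
  classical
  have hmem : (m, Finsupp.single i 1) ∈ Finset.antidiagonal (m + Finsupp.single i 1) := Finset.mem_antidiagonal.mpr rfl
  rw [coeff_mul, ← Finset.add_sum_erase _ _ hmem, Finset.sum_eq_zero, add_zero]
  rintro ⟨u, w⟩ huw'
  obtain ⟨hne, huw⟩ := Finset.mem_erase.mp huw'
  show coeff u T * coeff w B = 0
  by_cases hu : u ∈ T.support
  · have hmu : m ≤ u := hT u hu
    have hsum : u + w = m + Finsupp.single i 1 := Finset.mem_antidiagonal.mp huw
    -- off `i` the exponents of `u` agree with `m`, so `w` vanishes there; at `i`, `u i ∈ {m i, m i + 1}`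
    have hcoord : ∀ t, u t + w t = m t + (if i = t then 1 else 0) := fun t => by
      have h := DFunLike.congr_fun hsum t
      simp only [Finsupp.add_apply, Finsupp.single_apply] at h
      exact h
    by_cases hui : u i = m i
    · -- then `u = m`, `w = eᵢ`: the excluded term
      exfalso
      apply hne
      have hu' : u = m := by
        ext t
        have h := hcoord t; have hle := hmu t
        by_cases hti : i = t
        · subst hti; exact hui
        · rw [if_neg hti] at h; omega
      have hw' : w = Finsupp.single i 1 := by
        rw [hu'] at hsum; exact add_left_cancel hsum
      rw [hu', hw']
    · -- then `w = 0` and `B(0) = 0`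
      have hw0 : w = 0 := by
        ext t
        have h := hcoord t; have hle := hmu t
        rw [Finsupp.coe_zero, Pi.zero_apply]
        by_cases hti : i = t
        · subst hti; rw [if_pos rfl] at h; omega
        · rw [if_neg hti] at h; omega
      rw [hw0, hB0, mul_zero]
  · rw [MvPolynomial.notMem_support_iff.mp hu, zero_mul]

/-! ## 2. Linear coefficients of the bracket and the singleton criterion -/

omit [DecidableEq σ] [Fact p.Prime] [CharP K p] in
/-- The linear coefficients of a single-rooted split form supported in `R`. [folklore] -/
theorem coeff_single_splitForm (R : Finset K) (μ : σ → K → ℕ) (hS : ∀ i c, c ∉ R → μ i c = 0) (r : σ → K)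
    (hr : ∀ i c, μ i c ≠ 0 → r i = c) (i : σ) :
    coeff (Finsupp.single i 1) (∏ t, ∏ c ∈ R, (X t + C c) ^ μ t c : MvPolynomial σ K) =
      ∏ t, (((μ t (r t)).choose (Finsupp.single i 1 t) : K) * r t ^ (μ t (r t) - Finsupp.single i 1 t)) := by
  classical
  rw [splitForm_eq_prod_linearPow R μ hS r hr, WeightedBlowup.coeff_prod_X_add_C_pow]

omit [DecidableEq σ] [Fact p.Prime] in
/-- **The bracket has a non-zero linear term at every active variable** (active roots non-zero, `μ < p`). [folklore] -/
theorem coeff_single_bracket_ne_zero (R : Finset K) (μ : σ → K → ℕ) (γ₀ : K) (hS : ∀ i c, c ∉ R → μ i c = 0)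
    (hμ : ∀ i c, μ i c < p) (h1 : ∀ i c, μ i c ≠ 0 → ∀ c', c' ≠ c → μ i c' = 0) (hact : ∀ i c, μ i c ≠ 0 → c ≠ 0)
    {i₀ : σ} {c₀ : K} (hi₀ : μ i₀ c₀ ≠ 0) :
    coeff (Finsupp.single i₀ 1) ((∏ t, ∏ c ∈ R, (X t + C c) ^ μ t c : MvPolynomial σ K) - C γ₀) ≠ 0 := by
  classical
  let r : σ → K := fun i => if h : ∃ c, μ i c ≠ 0 then h.choose else 0
  have hr : ∀ i c, μ i c ≠ 0 → r i = c := fun i c hc => by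
    have hex : ∃ c, μ i c ≠ 0 := ⟨c, hc⟩
    have hri : r i = hex.choose := dif_pos hex
    rw [hri]
    by_contra hne
    exact hex.choose_spec (h1 i c hc _ hne)
  rw [coeff_sub, coeff_C, if_neg (Finsupp.single_ne_zero.mpr one_ne_zero).symm, sub_zero,
    coeff_single_splitForm R μ hS r hr i₀]
  refine Finset.prod_ne_zero_iff.mpr fun t _ => ?_
  by_cases ht : t = i₀
  · subst ht
    have hrt : r t = c₀ := hr t c₀ hi₀
    rw [Finsupp.single_eq_same, Nat.choose_one_right, hrt]
    refine mul_ne_zero ?_ (pow_ne_zero _ (hact t c₀ hi₀))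
    rw [Ne, CharP.cast_eq_zero_iff K p]
    exact fun hdvd => absurd (Nat.le_of_dvd (Nat.pos_of_ne_zero hi₀) hdvd) (not_le.mpr (hμ t c₀))
  · rw [Finsupp.single_eq_of_ne ht, Nat.choose_zero_right, Nat.cast_one, one_mul, Nat.sub_zero]
    by_cases h0 : μ t (r t) = 0
    · rw [h0, pow_zero]; exact one_ne_zero
    · exact pow_ne_zero _ (hact t (r t) h0)

omit [DecidableEq K] [Fact p.Prime] [CharP K p] in
/-- A CLEANED bracket has no constant term: `coeff 0 (N(R,μ) − C γ(R,μ)) = 0`. [folklore] -/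
theorem coeff_zero_bracket (R : Finset K) (μ : σ → K → ℕ) :
    coeff 0 ((∏ t, ∏ c ∈ R, (X t + C c) ^ μ t c : MvPolynomial σ K) - C (∏ t, ∏ c ∈ R, c ^ μ t c)) = 0 := by
  rw [coeff_sub, coeff_zero_splitForm, coeff_C, if_pos rfl, sub_self]

omit [Fact p.Prime] in
/-- **THE SINGLETON CRITERION in the bracket regime of a cleaned state**: active roots non-zero, some variable active, `k j 0 = 0`
⇒ `ord_{(x_j)} ≤ 1` (witness monomial: `corner(T) + e_{i₀}`). [folklore] -/
theorem ordAlong_singleton_generalForm_le_one (R : Finset K) (k μ : σ → K → ℕ)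
    (hSk : ∀ i c, c ∉ R → k i c = 0) (hSμ : ∀ i c, c ∉ R → μ i c = 0) (hμ : ∀ i c, μ i c < p)
    (h1 : ∀ i c, μ i c ≠ 0 → ∀ c', c' ≠ c → μ i c' = 0) (hact : ∀ i c, μ i c ≠ 0 → c ≠ 0)
    {i₀ : σ} {c₀ : K} (hi₀ : μ i₀ c₀ ≠ 0) {j : σ} (hj : k j 0 = 0) :
    ordAlong {j} ((∏ t, ∏ c ∈ R, (X t + C c) ^ (p * k t c) : MvPolynomial σ K) *
        ((∏ t, ∏ c ∈ R, (X t + C c) ^ μ t c) - C (∏ t, ∏ c ∈ R, c ^ μ t c))) ≤ 1 := by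
  have hSm : ∀ i c, c ∉ R → (fun i c => p * k i c) i c = 0 := fun i c hc => by
    show p * k i c = 0; rw [hSk i c hc, mul_zero]
  have hcoeff : coeff ((Finsupp.equivFunOnFinite.symm fun i => p * k i 0) + Finsupp.single i₀ 1)
      ((∏ t, ∏ c ∈ R, (X t + C c) ^ (p * k t c) : MvPolynomial σ K) *
        ((∏ t, ∏ c ∈ R, (X t + C c) ^ μ t c) - C (∏ t, ∏ c ∈ R, c ^ μ t c))) ≠ 0 := by
    rw [coeff_corner_add_single_mul _ _ _ (fun u hu => le_of_mem_support_splitForm R (fun i c => p * k i c) hSm hu)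
      (coeff_zero_bracket R μ) i₀]
    exact mul_ne_zero (coeff_corner_splitForm_ne_zero R (fun i c => p * k i c) hSm)
      (coeff_single_bracket_ne_zero p R μ _ hSμ hμ h1 hact hi₀)
  refine le_trans (ordAlong_le_of_coeff_ne_zero (S := {j}) hcoeff) ?_
  rw [degIn_singleton, Finsupp.add_apply, Finsupp.single_apply]
  have : (Finsupp.equivFunOnFinite.symm fun i => p * k i 0) j = p * k j 0 := rfl
  rw [this, hj, mul_zero, zero_add]
  split_ifs <;> simp

/-! ## 3. The measure `W(R; k, μ) = Σᵢ Σ_{c∈R} (p·k i c + μ i c)` -/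

omit [DecidableEq σ] [Fact p.Prime] [CharP K p] in
/-- Root shifts keep the measure (supports in `R`, new root set `R′ = ⋃ᵢ (R + bᵢ)`). [folklore] -/
theorem weight_shift (R : Finset K) (k μ : σ → K → ℕ) (hSk : ∀ i c, c ∉ R → k i c = 0) (hSμ : ∀ i c, c ∉ R → μ i c = 0)
    (b : σ → K) :
    ∑ i, ∑ c ∈ Finset.univ.biUnion (fun i => R.map (addRightEmbedding (b i))), (p * k i (c - b i) + μ i (c - b i)) =
      ∑ i, ∑ c ∈ R, (p * k i c + μ i c) := by
  refine Finset.sum_congr rfl fun i _ => ?_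
  have hsub : R.map (addRightEmbedding (b i)) ⊆ Finset.univ.biUnion (fun i => R.map (addRightEmbedding (b i))) :=
    Finset.subset_biUnion_of_mem (fun i => R.map (addRightEmbedding (b i))) (Finset.mem_univ i)
  rw [← Finset.sum_subset hsub (fun c _ hc => ?_)]
  · rw [Finset.sum_map]
    refine Finset.sum_congr rfl fun c _ => ?_
    simp [addRightEmbedding, add_sub_cancel_right]
  · have hc' : c - b i ∉ R := fun h => hc (Finset.mem_map.mpr ⟨c - b i, h, by simp [addRightEmbedding]⟩)
    rw [hSk i _ hc', hSμ i _ hc', mul_zero, add_zero]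

omit [Fact p.Prime] [CharP K p] in
/-- The singleton chart lowers the measure by `p` (`1 ≤ k j 0`, so `0 ∈ R`). [folklore] -/
theorem weight_singleton_chart (R : Finset K) (k μ : σ → K → ℕ) (h0 : (0 : K) ∈ R) {j : σ} (hj : 1 ≤ k j 0) :
    ∑ i, ∑ c ∈ R, (p * (if i = j ∧ c = 0 then k j 0 - 1 else k i c) + μ i c) + p = ∑ i, ∑ c ∈ R, (p * k i c + μ i c) := by
  have hsplit : ∀ f : σ → K → ℕ, ∑ i, ∑ c ∈ R, f i c = f j 0 + (∑ c ∈ R.erase 0, f j c + ∑ i ∈ Finset.univ.erase j, ∑ c ∈ R, f i c) :=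
    fun f => by
    rw [← Finset.add_sum_erase Finset.univ _ (Finset.mem_univ j), ← Finset.add_sum_erase R _ h0, add_assoc]
  rw [hsplit (fun i c => p * (if i = j ∧ c = 0 then k j 0 - 1 else k i c) + μ i c), hsplit (fun i c => p * k i c + μ i c)]
  have h1 : ∑ c ∈ R.erase 0, (p * (if j = j ∧ c = 0 then k j 0 - 1 else k j c) + μ j c) = ∑ c ∈ R.erase 0, (p * k j c + μ j c) :=
    Finset.sum_congr rfl fun c hc => by rw [if_neg (fun h => Finset.ne_of_mem_erase hc h.2)]
  have h2 : ∑ i ∈ Finset.univ.erase j, ∑ c ∈ R, (p * (if i = j ∧ c = 0 then k j 0 - 1 else k i c) + μ i c) =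
      ∑ i ∈ Finset.univ.erase j, ∑ c ∈ R, (p * k i c + μ i c) :=
    Finset.sum_congr rfl fun i hi => Finset.sum_congr rfl fun c _ => by rw [if_neg (fun h => Finset.ne_of_mem_erase hi h.1)]
  rw [h1, h2, if_pos ⟨rfl, rfl⟩]
  have : p * (k j 0 - 1) + p = p * k j 0 := by
    rw [Nat.mul_sub, mul_one, Nat.sub_add_cancel (Nat.le_mul_of_pos_right p hj)]
  omega

omit [Fact p.Prime] [CharP K p] in
/-- The minimal permissible block chart `μ j 0 ↦ Σ_S μ i 0 − p` lowers the measure (`0 ∈ R`). [folklore] -/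
theorem weight_block_chart_lt (R : Finset K) (k μ : σ → K → ℕ) (h0 : (0 : K) ∈ R) (S : Finset σ) {j : σ} (hj : j ∈ S)
    (hp : p ≤ ∑ i ∈ S, μ i 0) (hmin : (∑ i ∈ S.erase j, μ i 0) < p) :
    ∑ i, ∑ c ∈ R, (p * k i c + (if i = j ∧ c = 0 then (∑ i ∈ S, μ i 0) - p else μ i c)) < ∑ i, ∑ c ∈ R, (p * k i c + μ i c) := by
  have hsplit : ∀ f : σ → K → ℕ, ∑ i, ∑ c ∈ R, f i c = f j 0 + (∑ c ∈ R.erase 0, f j c + ∑ i ∈ Finset.univ.erase j, ∑ c ∈ R, f i c) :=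
    fun f => by
    rw [← Finset.add_sum_erase Finset.univ _ (Finset.mem_univ j), ← Finset.add_sum_erase R _ h0, add_assoc]
  rw [hsplit (fun i c => p * k i c + (if i = j ∧ c = 0 then (∑ i ∈ S, μ i 0) - p else μ i c)), hsplit (fun i c => p * k i c + μ i c)]
  have h1 : ∑ c ∈ R.erase 0, (p * k j c + (if j = j ∧ c = 0 then (∑ i ∈ S, μ i 0) - p else μ j c)) =
      ∑ c ∈ R.erase 0, (p * k j c + μ j c) :=
    Finset.sum_congr rfl fun c hc => by rw [if_neg (fun h => Finset.ne_of_mem_erase hc h.2)]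
  have h2 : ∑ i ∈ Finset.univ.erase j, ∑ c ∈ R, (p * k i c + (if i = j ∧ c = 0 then (∑ i ∈ S, μ i 0) - p else μ i c)) =
      ∑ i ∈ Finset.univ.erase j, ∑ c ∈ R, (p * k i c + μ i c) :=
    Finset.sum_congr rfl fun i hi => Finset.sum_congr rfl fun c _ => by rw [if_neg (fun h => Finset.ne_of_mem_erase hi h.1)]
  rw [h1, h2, if_pos ⟨rfl, rfl⟩]
  have hS : μ j 0 + ∑ i ∈ S.erase j, μ i 0 = ∑ i ∈ S, μ i 0 := Finset.add_sum_erase S (fun i => μ i 0) hj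
  omega

end PureLeafK

end Summit.ResolutionOfSingularities.ResolutionOfSingularities.Theorems.PIDim4

end
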